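import Literature.NumberTheory.LFunctions.Zhang2022.SkeletonPartOneB
import HarnessLib

/-!
# Zhang (2022), Lemma 5.3 at the centre `x = t₀`: `Δ(t₀) = (√π/𝓛₂)(1 + O(α)) + O(ε)` — a corollary of
# the discharged skeleton node `Lemma53` (module re-purposed; see the note)

Topic `Literature/NumberTheory/LFunctions/Zhang2022` (Landau–Siegel audit tree; verdict-neutral).
Y. Zhang, *Discrete mean estimates and the Landau–Siegel zero*, arXiv:2211.02515v1 (2022)
[Zhang2022LandauSiegel] — an unrefereed manuscript under adjudication; nothing here asserts or denies
its Theorems 1–2.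

NOTE (tree hygiene, cell siegel-zhang D-0069). This module's first version (p412467) proved
`Skeleton.lemma53_holds : Skeleton.Lemma53`. The same declaration — same fully-qualified name, same
statement — landed concurrently in `Literature.NumberTheory.LFunctions.Zhang2022.Section5Lemma53`
(p412432, the discharge OF RECORD of unit D06, with the reusable bookkeeping lemmas
`Skeleton.lemma53_caseOne_core`, `lemma53_caseOne`, `lemma53_caseTwo`); the two proposals were verified
in concurrent batches, so the duplicate was not caught, and the umbrella `Literature.lean` imports both.
To restore a single declaration of `Skeleton.lemma53_holds` this module no longer declares it; it
keeps only a corollary OF THE NODE (hypothesis form `(h : Lemma53)`, fed by `Skeleton.lemma53_holds` of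
`Section5Lemma53`) that is not stated elsewhere:

* `Skeleton.Lemma53.norm_DeltaW_t0_sub_le` — (5.8) at `x = t₀` (where `ω(1/2+2πit₀) = √π/𝓛₂`
  exactly): `‖Δ(t₀) − √π/𝓛₂‖ ≤ Cα·√π/𝓛₂ + e^{−c𝓛¹⁰}` for all large `D`.

## References

* Y. Zhang, arXiv:2211.02515v1 (2022), §5 p. 25, Lemma 5.3 (5.8) and the Note before it
  (`ω(1/2+2πix) = (√π/𝓛₂)exp{−(π(x−t₀)/𝓛₂)²}`). [cite: Zhang2022LandauSiegel, §5 Lemma 5.3 p.25]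
-/

noncomputable section

open Complex Real

namespace Literature.NumberTheory.LFunctions.Zhang2022.Skeleton

/-- **(5.8) at the centre of the weight**: `‖Δ(t₀) − √π/𝓛₂‖ ≤ Cα(√π/𝓛₂) + e^{−c𝓛¹⁰}` for all
sufficiently large `D` (some absolute `c > 0`, `C`) — the node Lemma 5.3 (`h : Lemma53`; kernel: `Skeleton.lemma53_holds` in `Section5Lemma53`) at
`x = t₀ ≤ t₀^{1.02}`, where `ω(1/2+2πit₀) = √π/𝓛₂` (`SmoothWeight.omega_half_eq`).
[cite: Zhang2022LandauSiegel, §5 Lemma 5.3 (5.8) p.25] -/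
theorem Lemma53.norm_DeltaW_t0_sub_le (h : Lemma53) :
    ∃ c : ℝ, 0 < c ∧ ∃ C : ℝ, ForAllLarge fun D _ _ =>
      ‖DeltaW D (t0 D) - (Real.sqrt π / ell2 D : ℝ)‖ ≤
        C * alpha D * (Real.sqrt π / ell2 D) + Real.exp (-c * ell D ^ 10) := by
  obtain ⟨c, hc, C, D₀, h⟩ := h
  refine ⟨c, hc, max C 0, max D₀ 3, fun D _ χ hD hq hp => ?_⟩
  have hD₀ : D₀ ≤ D := le_trans (le_max_left _ _) hD
  have hD3 : 3 ≤ D := le_trans (le_max_right _ _) hD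
  have hD' : (3 : ℝ) ≤ D := by exact_mod_cast hD3
  have hL : 1 ≤ ell D := by
    have h3 : (1 : ℝ) ≤ Real.log 3 := by
      rw [Real.le_log_iff_exp_le (by norm_num)]
      exact Real.exp_one_lt_d9.le.trans (by norm_num)
    exact h3.trans (Real.log_le_log (by norm_num) hD')
  have ht0 : 1 ≤ t0 D := one_le_pow₀ hL
  have ht0pos : 0 < t0 D := lt_of_lt_of_le one_pos ht0
  have hL2 : ell2 D ≠ 0 := (pow_pos (lt_of_lt_of_le one_pos hL) 400).ne'
  have hle : t0 D ≤ t0 D ^ (1.02 : ℝ) := by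
    conv_lhs => rw [← Real.rpow_one (t0 D)]
    exact Real.rpow_le_rpow_of_exponent_le ht0 (by norm_num)
  have h1 := (h D χ hD₀ hq hp (t0 D) ht0pos).1 hle
  have hω : omegaW D (1 / 2 + 2 * π * (t0 D) * I) = ((Real.sqrt π / ell2 D : ℝ) : ℂ) := by
    rw [omegaW, SmoothWeight.omega_half_eq hL2, SmoothWeight.omegaLine]
    simp
  have hnn : 0 ≤ Real.sqrt π / ell2 D :=
    div_nonneg (Real.sqrt_nonneg _) (pow_nonneg (zero_le_one.trans hL) _)
  rw [hω, Complex.norm_real, Real.norm_eq_abs, abs_of_nonneg hnn] at h1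
  show ‖DeltaW D (t0 D) - ((Real.sqrt π / ell2 D : ℝ) : ℂ)‖ ≤
    max C 0 * alpha D * (Real.sqrt π / ell2 D) + Real.exp (-c * ell D ^ 10)
  refine h1.trans (add_le_add (mul_le_mul_of_nonneg_right (mul_le_mul_of_nonneg_right
    (le_max_left _ _) ?_) hnn) le_rfl)
  rw [alpha, bigP, Real.log_exp]; positivity

end Literature.NumberTheory.LFunctions.Zhang2022.Skeleton
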